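import Mathlib.Analysis.SpecialFunctions.Pow.Deriv
import Mathlib.Analysis.SpecialFunctions.Pow.Asymptotics
import Mathlib.Analysis.Calculus.MeanValue
import Mathlib.Analysis.Complex.RealDeriv
import Literature.Geometry.Lorentzian.TeukolskyStarobinskyHeun
import HarnessLib

/-!
# Venture KdS — analysis toolkit for the Teukolsky–Starobinsky transfer (I): branches and
# iterated derivatives

HONEST FRAMING (venture `Summits/Ventures/KdS`, cell `pub-kds`): elementary real analysis used by
`RouteWSpinFlip.lean` (the Teukolsky–Starobinsky map `s ↦ −s` realised as Umetsu's `2s`-th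
derivative in a flipped Heun frame). Nothing here mentions Kerr–de Sitter. Contents:

* iterated derivatives of smooth functions on open sets are taken from the tree's Kerr file
  `TeukolskyStarobinskyHeun` (`Kerr.Costa2019.iterate_deriv_smooth`, `iterate_deriv_eqOn`);
* `branchCoeff`, `iterate_deriv_branch`: for `Q` smooth near `1`,
  `(d/dx)^k [(1−x)^ν Q(x)] = (1−x)^{ν−k} H_k(x)` on the left of `1`, with `H_k` smooth ACROSS `1` and
  `H_k(1) = (−1)^k ν(ν−1)⋯(ν−k+1) Q(1)` (principal powers of the positive real `1 − x`);
* `natural_of_smooth_branch`: if `(1−x)^ν Q(x)` (`Q(1) ≠ 0`) agrees on the left of `1` with a function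
  smooth across `1`, then `ν ∈ ℕ` (otherwise a high derivative blows up like `(1−x)^{Re ν − k}`);
* `iterate_deriv_of_branch`, `iterate_deriv_of_agree`: shapes of iterated derivatives transported
  along local agreements near `1⁻` and `0⁺`.
-/

noncomputable section

open Set Complex Filter Topology Polynomial

namespace Summit.Ventures.KdS

namespace SpinFlipTS

open Literature.Geometry.Lorentzian.Kerr.Costa2019 (iterate_deriv_smooth iterate_deriv_eqOn)

/-! ### The branch `(1−x)^ν · Q(x)` and its iterated derivatives -/

/-- The cofactor recursion: `H₀ = Q`, `H_{k+1} = −(ν−k)·H_k + (1−x)·H_k'`. -/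
def branchCoeff (ν : ℂ) (Q : ℝ → ℂ) : ℕ → ℝ → ℂ
  | 0 => Q
  | k + 1 => fun x => -(ν - k) * branchCoeff ν Q k x + ((1 - x : ℝ) : ℂ) * deriv (branchCoeff ν Q k) x

/-- `x ↦ ((1−x : ℝ) : ℂ)` is smooth. -/
private theorem contDiff_cast_one_sub :
    ContDiff ℝ ((⊤ : ℕ∞) : WithTop ℕ∞) (fun x : ℝ => ((1 - x : ℝ) : ℂ)) :=
  Complex.ofRealCLM.contDiff.comp (contDiff_const.sub contDiff_id)

/-- The cofactors are smooth wherever `Q` is (open set). -/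
theorem branchCoeff_smooth (ν : ℂ) {Q : ℝ → ℂ} {U : Set ℝ} (hU : IsOpen U)
    (hQ : ContDiffOn ℝ ((⊤ : ℕ∞) : WithTop ℕ∞) Q U) (k : ℕ) :
    ContDiffOn ℝ ((⊤ : ℕ∞) : WithTop ℕ∞) (branchCoeff ν Q k) U := by
  induction k with
  | zero => exact hQ
  | succ k ih =>
    have hd : ContDiffOn ℝ ((⊤ : ℕ∞) : WithTop ℕ∞) (deriv (branchCoeff ν Q k)) U :=
      ih.deriv_of_isOpen hU le_rfl
    exact (contDiffOn_const.mul ih).add (contDiff_cast_one_sub.contDiffOn.mul hd)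

/-- Value at `1`: `H_k(1) = (−1)^k · ∏_{i<k}(ν − i) · Q(1)`. -/
theorem branchCoeff_one (ν : ℂ) (Q : ℝ → ℂ) (k : ℕ) :
    branchCoeff ν Q k 1 = (-1) ^ k * (∏ i ∈ Finset.range k, (ν - i)) * Q 1 := by
  induction k with
  | zero => simp [branchCoeff]
  | succ k ih =>
    simp only [branchCoeff]
    rw [ih, Finset.prod_range_succ]
    push_cast
    ring

/-- `d/dx (c − x)^p = (c − x)^p · p/(x − c)` for `x < c` (principal power of a positive real). -/
private theorem hasDerivAt_const_sub_cpow (c : ℝ) (p : ℂ) {r : ℝ} (hr : r < c) :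
    HasDerivAt (fun x : ℝ => ((c - x : ℝ) : ℂ) ^ p)
      (((c - r : ℝ) : ℂ) ^ p * (p / ((r : ℂ) - c))) r := by
  have hpos : (0 : ℝ) < c - r := sub_pos.2 hr
  have hslit : ((c : ℂ) - r) ∈ slitPlane := by
    rw [← Complex.ofReal_sub]
    exact Complex.ofReal_mem_slitPlane.2 hpos
  have hne : ((c - r : ℝ) : ℂ) ≠ 0 := by exact_mod_cast hpos.ne'
  have hne' : ((r : ℂ) - c) ≠ 0 := by
    have : ((r - c : ℝ) : ℂ) ≠ 0 := by exact_mod_cast (show r - c ≠ 0 by linarith)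
    simpa using this
  have h1 : HasDerivAt (fun z : ℂ => (c - z) ^ p) (p * ((c : ℂ) - r) ^ (p - 1) * -1) (r : ℂ) :=
    ((hasDerivAt_id (r : ℂ)).const_sub (c : ℂ)).cpow_const hslit
  have hfun : (fun x : ℝ => ((c - x : ℝ) : ℂ) ^ p) = fun y : ℝ => ((c : ℂ) - y) ^ p := by
    funext y
    rw [Complex.ofReal_sub]
  rw [hfun]
  refine h1.comp_ofReal.congr_deriv ?_
  rw [← Complex.ofReal_sub, Complex.cpow_sub _ _ hne, Complex.cpow_one]
  have e : ((c - r : ℝ) : ℂ) = -((r : ℂ) - c) := by push_cast; ring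
  rw [e]
  field_simp

/-- A principal power of a positive real is non-zero. -/
theorem ofReal_cpow_ne_zero {t : ℝ} (ht : 0 < t) (p : ℂ) : ((t : ℝ) : ℂ) ^ p ≠ 0 := fun h =>
  ht.ne' (by exact_mod_cast ((Complex.cpow_eq_zero_iff _ _).1 h).1)

/-- **Iterated derivatives of a branch.** If `Q` is smooth on `(1−e, 1+e)`, then for every `k` and
every `x ∈ (1−e, 1)`,
`(d/dx)^k [(1−x)^ν Q(x)] = (1−x)^{ν−k} · H_k(x)` with `H_k = branchCoeff ν Q k`. -/
theorem iterate_deriv_branch (ν : ℂ) {Q : ℝ → ℂ} {e : ℝ}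
    (hQ : ContDiffOn ℝ ((⊤ : ℕ∞) : WithTop ℕ∞) Q (Ioo (1 - e) (1 + e))) (k : ℕ) :
    ∀ x ∈ Ioo (1 - e) 1,
      (deriv^[k] fun t => ((1 - t : ℝ) : ℂ) ^ ν * Q t) x =
        ((1 - x : ℝ) : ℂ) ^ (ν - k) * branchCoeff ν Q k x := by
  induction k with
  | zero => intro x _; simp [branchCoeff]
  | succ k ih =>
    intro x hx
    have hxW : x ∈ Ioo (1 - e) (1 + e) := ⟨hx.1, by linarith [hx.1, hx.2]⟩
    have hW : IsOpen (Ioo (1 - e) (1 + e)) := isOpen_Ioo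
    have hS : IsOpen (Ioo (1 - e) (1 : ℝ)) := isOpen_Ioo
    rw [Function.iterate_succ_apply']
    -- replace the k-th derivative by its closed form near x
    have hloc : (deriv^[k] fun t => ((1 - t : ℝ) : ℂ) ^ ν * Q t) =ᶠ[𝓝 x]
        fun t => ((1 - t : ℝ) : ℂ) ^ (ν - k) * branchCoeff ν Q k t := by
      filter_upwards [hS.mem_nhds hx] with t ht using ih t ht
    rw [hloc.deriv_eq]
    -- differentiate the closed form
    have hH : HasDerivAt (branchCoeff ν Q k) (deriv (branchCoeff ν Q k) x) x :=
      (((branchCoeff_smooth ν hW hQ k).differentiableOn (by simp)).differentiableAt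
        (hW.mem_nhds hxW)).hasDerivAt
    have hP := hasDerivAt_const_sub_cpow 1 (ν - k) hx.2
    have hne : ((1 - x : ℝ) : ℂ) ≠ 0 := by exact_mod_cast (show (1 - x : ℝ) ≠ 0 by linarith [hx.2])
    have hne' : (x : ℂ) - 1 ≠ 0 := by
      have : ((x - 1 : ℝ) : ℂ) ≠ 0 := by exact_mod_cast (show x - 1 ≠ 0 by linarith [hx.2])
      simpa using this
    have hprod : HasDerivAt (fun t => ((1 - t : ℝ) : ℂ) ^ (ν - k) * branchCoeff ν Q k t)
        (((1 - x : ℝ) : ℂ) ^ (ν - k) * ((ν - k) / ((x : ℂ) - 1)) * branchCoeff ν Q k x +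
          ((1 - x : ℝ) : ℂ) ^ (ν - k) * deriv (branchCoeff ν Q k) x) x := hP.mul hH
    rw [hprod.deriv]
    -- `(1−x)^{ν−k} = (1−x)^{ν−(k+1)} · (1−x)`
    have hsplit : ((1 - x : ℝ) : ℂ) ^ (ν - (k : ℕ)) =
        ((1 - x : ℝ) : ℂ) ^ (ν - ((k + 1 : ℕ) : ℂ)) * ((1 - x : ℝ) : ℂ) := by
      conv_lhs => rw [show ν - ((k : ℕ) : ℂ) = (ν - ((k + 1 : ℕ) : ℂ)) + 1 by push_cast; ring]
      rw [Complex.cpow_add _ _ hne, Complex.cpow_one]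
    rw [show branchCoeff ν Q (k + 1) x =
        -(ν - k) * branchCoeff ν Q k x + ((1 - x : ℝ) : ℂ) * deriv (branchCoeff ν Q k) x from rfl]
    rw [hsplit]
    have e1 : ((1 - x : ℝ) : ℂ) = -((x : ℂ) - 1) := by push_cast; ring
    rw [e1]
    field_simp

/-! ### A branch extending smoothly across `1` has a natural exponent -/

/-- `x ↦ 1 − x` maps the left neighbourhoods of `1` to the right neighbourhoods of `0`. -/
private theorem tendsto_one_sub_nhdsLT :
    Tendsto (fun x : ℝ => 1 - x) (𝓝[<] (1 : ℝ)) (𝓝[>] (0 : ℝ)) := by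
  refine tendsto_nhdsWithin_iff.mpr ⟨?_, ?_⟩
  · have h : Tendsto (fun x : ℝ => 1 - x) (𝓝 (1 : ℝ)) (𝓝 (1 - 1)) :=
      ((continuous_const.sub continuous_id).tendsto (1 : ℝ))
    rw [sub_self] at h
    exact h.mono_left nhdsWithin_le_nhds
  · filter_upwards [self_mem_nhdsWithin] with x hx
    exact sub_pos.mpr (mem_Iio.mp hx)

/-- `(1−x)^{c} → +∞` as `x → 1⁻` for `c < 0` (real powers). -/
private theorem tendsto_one_sub_rpow_atTop {c : ℝ} (hc : c < 0) :
    Tendsto (fun x : ℝ => (1 - x) ^ c) (𝓝[<] (1 : ℝ)) atTop := by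
  have h2 := (tendsto_rpow_atTop (show 0 < -c by linarith)).comp
    (tendsto_inv_nhdsGT_zero.comp tendsto_one_sub_nhdsLT)
  refine h2.congr' ?_
  filter_upwards [self_mem_nhdsWithin] with x hx
  have hx' : (0 : ℝ) ≤ 1 - x := by simp only [mem_Iio] at hx; linarith
  simp only [Function.comp]
  rw [Real.inv_rpow hx', ← Real.rpow_neg hx', neg_neg]

/-- **A branch that extends smoothly across `1` has a natural exponent.** If `Q` and `G` are smooth on
`(1−e, 1+e)`, `Q(1) ≠ 0`, and `(1−x)^ν Q(x) = G(x)` for `x ∈ (1−e, 1)`, then `ν ∈ ℕ`. (Otherwise,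
with `k > Re ν`, the `k`-th derivative of the left side is `(1−x)^{ν−k} H_k(x)` with
`H_k(1) = (−1)^k ν(ν−1)⋯(ν−k+1) Q(1) ≠ 0`, unbounded as `x → 1⁻`, while `G^{(k)}` is continuous at
`1`.) -/
theorem natural_of_smooth_branch {ν : ℂ} {Q G : ℝ → ℂ} {e : ℝ} (he : 0 < e)
    (hQ : ContDiffOn ℝ ((⊤ : ℕ∞) : WithTop ℕ∞) Q (Ioo (1 - e) (1 + e))) (hQ1 : Q 1 ≠ 0)
    (hG : ContDiffOn ℝ ((⊤ : ℕ∞) : WithTop ℕ∞) G (Ioo (1 - e) (1 + e)))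
    (hagree : ∀ x ∈ Ioo (1 - e) 1, ((1 - x : ℝ) : ℂ) ^ ν * Q x = G x) :
    ∃ n : ℕ, ν = n := by
  by_contra hcon'
  have hcon : ∀ n : ℕ, ν ≠ n := fun n h => hcon' ⟨n, h⟩
  set k : ℕ := ⌈ν.re⌉₊ + 1 with hk
  have hkre : ν.re < k := by
    have h1 := Nat.le_ceil ν.re
    rw [hk]; push_cast; linarith
  set W : Set ℝ := Ioo (1 - e) (1 + e) with hWdef
  have hW : IsOpen W := isOpen_Ioo
  have h1W : (1 : ℝ) ∈ W := ⟨by linarith, by linarith⟩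
  set H := branchCoeff ν Q k with hHdef
  have hHs : ContDiffOn ℝ ((⊤ : ℕ∞) : WithTop ℕ∞) H W := branchCoeff_smooth ν hW hQ k
  have hH1 : H 1 ≠ 0 := by
    rw [hHdef, branchCoeff_one]
    refine mul_ne_zero (mul_ne_zero (pow_ne_zero _ (by norm_num)) ?_) hQ1
    rw [Finset.prod_ne_zero_iff]
    intro i _
    exact sub_ne_zero.mpr (hcon i)
  obtain ⟨hDk, -⟩ := iterate_deriv_smooth hW hG k
  have hleft : ∀ x ∈ Ioo (1 - e) 1, (deriv^[k] G) x = ((1 - x : ℝ) : ℂ) ^ (ν - k) * H x := by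
    intro x hx
    have heq : EqOn G (fun t => ((1 - t : ℝ) : ℂ) ^ ν * Q t) (Ioo (1 - e) 1) :=
      fun t ht => (hagree t ht).symm
    rw [iterate_deriv_eqOn isOpen_Ioo heq k hx]
    exact iterate_deriv_branch ν hQ k x hx
  have hcG : ContinuousAt (deriv^[k] G) 1 :=
    (hDk.continuousOn.continuousWithinAt h1W).continuousAt (hW.mem_nhds h1W)
  have hcH : ContinuousAt H 1 :=
    (hHs.continuousOn.continuousWithinAt h1W).continuousAt (hW.mem_nhds h1W)
  set B : ℝ := ‖(deriv^[k] G) 1‖ + 1 with hBdef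
  have hB : 0 < B := by positivity
  have hH1n : 0 < ‖H 1‖ := norm_pos_iff.mpr hH1
  set h₀ : ℝ := ‖H 1‖ / 2 with hh₀def
  have hh₀ : 0 < h₀ := by positivity
  have evG : ∀ᶠ x in 𝓝 (1 : ℝ), ‖(deriv^[k] G) x‖ ≤ B := by
    have h := (Metric.tendsto_nhds.mp hcG) 1 one_pos
    filter_upwards [h] with x hx
    rw [dist_eq_norm] at hx
    have := norm_le_insert' ((deriv^[k] G) x) ((deriv^[k] G) 1)
    linarith [hx.le]
  have evH : ∀ᶠ x in 𝓝 (1 : ℝ), h₀ ≤ ‖H x‖ := by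
    have h := (Metric.tendsto_nhds.mp hcH) h₀ hh₀
    filter_upwards [h] with x hx
    rw [dist_eq_norm] at hx
    have := norm_le_insert' (H 1) (H x)
    rw [norm_sub_rev] at this
    linarith
  have evBig : ∀ᶠ x in 𝓝[<] (1 : ℝ), B / h₀ < (1 - x) ^ (ν.re - k) :=
    (tendsto_one_sub_rpow_atTop (show ν.re - k < 0 by linarith)).eventually_gt_atTop _
  have evIn : ∀ᶠ x in 𝓝[<] (1 : ℝ), x ∈ Ioo (1 - e) 1 := Ioo_mem_nhdsLT (by linarith)
  obtain ⟨x, hxbig, hxin, hxG, hxH⟩ :=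
    (evBig.and (evIn.and ((evG.filter_mono nhdsWithin_le_nhds).and
      (evH.filter_mono nhdsWithin_le_nhds)))).exists
  have hpos1 : 0 < 1 - x := by linarith [hxin.2]
  have hnorm : ‖(deriv^[k] G) x‖ = (1 - x) ^ (ν.re - k) * ‖H x‖ := by
    rw [hleft x hxin, norm_mul, Complex.norm_cpow_eq_rpow_re_of_pos hpos1]
    simp
  have hrp : 0 ≤ (1 - x) ^ (ν.re - k) := Real.rpow_nonneg hpos1.le _
  have hlt : B < ‖(deriv^[k] G) x‖ := by
    rw [hnorm]
    calc B = (B / h₀) * h₀ := by field_simp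
      _ < (1 - x) ^ (ν.re - k) * h₀ := by gcongr
      _ ≤ (1 - x) ^ (ν.re - k) * ‖H x‖ := by gcongr
  linarith

/-! ### Shapes of iterated derivatives transported along local agreements -/

/-- Near `1⁻`: if `u = (1−x)^μ G` on `(1−e,1)` with `G` smooth on `(1−e,1+e)`, then for every `k`,
`u^{(k)} = (1−x)^{μ−k} · H_k` on `(1−e,1)` with `H_k = branchCoeff μ G k` (smooth on `(1−e,1+e)` by
`branchCoeff_smooth`). -/
theorem iterate_deriv_of_branch {u G : ℝ → ℂ} {μ : ℂ} {e : ℝ}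
    (hG : ContDiffOn ℝ ((⊤ : ℕ∞) : WithTop ℕ∞) G (Ioo (1 - e) (1 + e)))
    (hbranch : ∀ x ∈ Ioo (1 - e) 1, u x = ((1 - x : ℝ) : ℂ) ^ μ * G x) (k : ℕ) :
    ∀ x ∈ Ioo (1 - e) 1,
      (deriv^[k] u) x = ((1 - x : ℝ) : ℂ) ^ (μ - k) * branchCoeff μ G k x := by
  intro x hx
  have heq : EqOn u (fun t => ((1 - t : ℝ) : ℂ) ^ μ * G t) (Ioo (1 - e) 1) := fun t ht => hbranch t ht
  rw [iterate_deriv_eqOn isOpen_Ioo heq k hx]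
  exact iterate_deriv_branch μ hG k x hx

/-- Near `0⁺`: if `u = F` on `(0,e)` with `F` smooth on `(−e,e)`, then `u^{(k)} = F^{(k)}` on `(0,e)`
and `F^{(k)}` is smooth on `(−e,e)`. -/
theorem iterate_deriv_of_agree {u F : ℝ → ℂ} {e : ℝ}
    (hF : ContDiffOn ℝ ((⊤ : ℕ∞) : WithTop ℕ∞) F (Ioo (-e) e))
    (hagree : ∀ x ∈ Ioo 0 e, u x = F x) (k : ℕ) :
    ContDiffOn ℝ ((⊤ : ℕ∞) : WithTop ℕ∞) (deriv^[k] F) (Ioo (-e) e) ∧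
      ∀ x ∈ Ioo 0 e, (deriv^[k] u) x = (deriv^[k] F) x :=
  ⟨(iterate_deriv_smooth isOpen_Ioo hF k).1,
    fun _ hx => iterate_deriv_eqOn isOpen_Ioo (fun t ht => hagree t ht) k hx⟩

end SpinFlipTS

end Summit.Ventures.KdS
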